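import Summits.FinalStateConjecture.FinalStateConjecture.Theses.BurnettKineticRigidity
import Literature.Geometry.Lorentzian.TameGenericityLocal

/-!
# Crux `CensorshipViolationCodim` — line `birth`: BIRTH SKELETON (BC3; skeleton registrar, 2026-08-17)

Crux item `stmt-FinalStateConjecture-17294`, decl (FIXED, concluded BY NAME in
`CensorshipViolationCodim_of`):
`Summit.FinalStateConjecture.FinalStateConjecture.Theses.BurnettKineticRigidity.CensorshipViolationCodim`
(route `route-FinalStateConjecture-BurnettKineticRigidity`, crux rank 4) — CENSORSHIP-VIOLATION
CODIMENSION, TAME FORM: through every admissible vacuum datum `D` possessing an MGHD with INCOMPLETE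
future null infinity pass ONE asymptotically flat end `e` and an injective one-parameter family of
admissible data, tame on `e`, immersed at `0`, `F 0 = D`, ALL of whose other members are GOOD: every
MGHD has complete `𝓘⁺` and settles (summit sense) whenever it carries a photon-region remnant.

## The cut (the route's own TWO-LAYER PLAN for this crux: "vacuum naked-singularity instability →
## landing in the good set → glue"), typed over existing declarations only

The crux is an ESCAPE statement out of the censorship-violating stratum
`V = {D admissible | some MGHD of D has incomplete 𝓘⁺}` INTO the good set
`G = {D' | every MGHD complete ∧ (remnant → settles)}` along a tame immersed curve. Christodoulou
genericity is not closed under conjunction (`TameGenericityDiagonal.lean`, docstring of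
`isTameChristodoulouGeneric_of_relative`: a generic HYPOTHESIS enters the proof of a generic
CONCLUSION along its witness curves, never pointwise), so the honest two pieces are:

* `stub_weakCosmicCensorship` — WEAK COSMIC CENSORSHIP in Christodoulou's positive-codimension
  formulation, TAME and LOCAL in the parameter: through every `D ∈ V` passes a tame immersed injective
  admissible curve `F`, `F 0 = D`, whose members with `0 < ‖c‖ < ε` are CENSORED (every MGHD has
  complete `𝓘⁺`). This is exactly the classical conjecture (Christodoulou CQG 16 (1999) A23 p. A24;
  Dafermos–Rodnianski arXiv:0811.0354 §2.6.2) in the tree's tame notion; nothing about settling.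
  [open-problem; XL]
* `stub_landing` — LANDING IN THE GOOD SET ALONG CENSORED CURVES: given a tame immersed injective
  admissible curve `F` through a datum `F 0 ∈ V`, censored off `0`, there is (possibly on another end,
  through the same base datum) a tame immersed injective admissible curve whose SMALL members are
  GOOD — i.e. the censoring escape can be steered off the THRESHOLD stratum
  `T = {complete ∧ remnant ∧ ¬ settles}` (extremal `|a| = M` formation, photon-shell remnants) near a
  violating datum. The `hrel`-shape of `isTameChristodoulouGeneric_of_relative'` with `Q = censored`,
  `P = good`, restricted to base data in `V`. [open-problem; L–XL]

Composition `CensorshipViolationCodim_of` (kernel-checked, no `sorry` of its own, ~15 lines): WCC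
gives a locally censoring curve through `D`; the LANDED radial reparametrisation
`InitialDataSet.exists_tameCurve_of_local` (TameGenericityLocal.lean) makes it censored at every
`c ≠ 0`; `stub_landing` hands back a locally good curve through the same base datum (`subst`); the same
landed lemma globalises it; this is the crux verbatim. Both stubs are LOCAL in the parameter and the
crux is GLOBAL — the seam is the tree's reparametrisation theorem, not `exact ⟨h₁, h₂⟩`.

Logical position: crux ⟹ each stub (weakening: good ⟹ censored; ignore the given curve), and
stub₁ ∧ stub₂ ⟹ crux (this file); neither stub alone is the crux: `stub_weakCosmicCensorship` says
nothing about thresholds/settling, `stub_landing` produces nothing without a censoring curve.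

## BC3 probes (seat folder `bc/CensorshipViolationCodim_probes{,A,B,C}.lean`; they import the route file
## only — NOT this skeleton — so no sorried theorem concluding the crux is in scope for `exact?`)
For each stub `S` (signature restated verbatim): `S → CensorshipViolationCodim` and
`S → FinalStateConjecture`. Combined `first | exact? | simpa | aesop` (400 000 heartbeats): all four
FAIL (rc 1, deterministic timeout inside the combinator). One tactic per example, so that every attempt
terminates on its own: `exact?` → "could not close the goal" ×4; `simpa` → "assumption failed" ×4;
`simpa [CensorshipViolationCodim, FinalStateConjecture]` → "assumption failed" ×4; `simpa using h` →
"type mismatch" ×4; `aesop` → "failed to prove the goal after exhaustive search" ×2 (Stub 1) and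
normalisation-simp timeout ×2 (Stub 2; re-run with 2 000 000 heartbeats / `enableSimp := false` in
file C — see the log in `Lines/birth.md`). No probe succeeds: neither stub is cheaply the crux or the
summit.

## Disproof used
None relevant: the crux has no `Disproof.lean` / Negative lemmas yet (`ledger crux ls`: no workfiles
before this one); `ledger negatives --problem FinalStateConjecture` lists one unrelated refutation
(`not_UniformPhotonSphereChannels`). Neither stub is an instance of it.
-/

noncomputable section

-- the doubled `FinalStateConjecture.FinalStateConjecture` path component trips dupNamespace
set_option linter.dupNamespace false

namespace Summit.FinalStateConjecture.FinalStateConjecture.Cruxes.CensorshipViolationCodim.Birth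

open Set Filter Function Topology TopologicalSpace
open scoped Manifold ContDiff
open Literature.Geometry.Lorentzian
open Summit.FinalStateConjecture.FinalStateConjecture.Theses.BurnettKineticRigidity

/-! ## §1 The two statements of the line (named; nothing here is a route item) -/

/-- **WEAK COSMIC CENSORSHIP, tame positive-codimension form, local in the parameter**
(`stub_weakCosmicCensorship`): for every admissible vacuum datum `D` on `X` possessing a maximal
vacuum Cauchy development with INCOMPLETE future null infinity there are one asymptotically flat end
`e` of `X`, an injective one-parameter family `F` of admissible data, tame on `e`
(`IsTameDataFamily`: jointly smooth, `e` the sole end, Dafermos–Rodnianski asymptotics on `e` with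
continuous mass, `wDist`-continuous at `0`) and immersed at `0` (`IsImmersedAtZero`), with `F 0 = D`,
and an `ε > 0` such that for `0 < ‖c‖ < ε` EVERY maximal vacuum Cauchy development of `F c` has
complete `𝓘⁺`. Christodoulou's formulation of weak cosmic censorship ("the exceptional set has
positive codimension in a fixed space of data with fixed asymptotics"), proved for the spherically
symmetric scalar field (Ann. Math. 149 (1999) 183, Thm. p. 187: lines `α₀ + c f`), OPEN in vacuum
without symmetry; local because every instability construction controls small parameters only (the
tree's `hasTameCodimAtLeastIn_of_local` shows local = global for the tame notion). Why it might fail: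
the exterior-naked-singularity vacuum solutions of Rodnianski–Shlapentokh-Rothman (arXiv:1912.08478)
may be stable under smooth admissible perturbations at FIXED asymptotics (tameness forbids censoring
by a far-out giant hole); blue-shift/trapped-surface-formation instability is known only in symmetry
or for the scalar-field model (Christodoulou 1999; Liu–Li arXiv:1710.03422; An arXiv:2401.02003-type
results). [cite: Christodoulou1999, p. A24] [cite: arXiv08110354, §2.6.2] -/
def WeakCosmicCensorshipTame : Prop :=
  ∀ (X : Type) [TopologicalSpace X] [ChartedSpace Literature.Geometry.Lorentzian.E3 X] [IsManifold (𝓡 3) ∞ X] [T2Space X]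
    [SecondCountableTopology X] [ConnectedSpace X],
    ∀ D ∈ Literature.Geometry.Lorentzian.admissibleVacuumData X,
      (∃ 𝒟 : Literature.Geometry.Lorentzian.VacuumCauchyDevelopment D, 𝒟.IsMaximal ∧
        ¬ Summit.FinalStateConjecture.HasCompleteNullInfinity 𝒟.toCauchyDevelopment) →
      ∃ (e : Literature.Geometry.Lorentzian.AFEnd X) (F : EuclideanSpace ℝ (Fin 1) → Literature.Geometry.Lorentzian.InitialDataSet (𝓡 3) X),
        Literature.Geometry.Lorentzian.InitialDataSet.IsTameDataFamily e 1 F ∧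
          Literature.Geometry.Lorentzian.InitialDataSet.IsImmersedAtZero 1 F ∧ F 0 = D ∧ Function.Injective F ∧
            (∀ c, F c ∈ Literature.Geometry.Lorentzian.admissibleVacuumData X) ∧
              ∃ ε > (0 : ℝ), ∀ c, c ≠ 0 → ‖c‖ < ε →
                ∀ 𝒟 : Literature.Geometry.Lorentzian.VacuumCauchyDevelopment (F c), 𝒟.IsMaximal →
              Summit.FinalStateConjecture.HasCompleteNullInfinity 𝒟.toCauchyDevelopment

/-- **LANDING IN THE GOOD SET ALONG CENSORED CURVES** (`stub_landing`): for every end `e` and every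
tame (on `e`), immersed-at-`0`, injective curve `F` of admissible vacuum data whose base datum `F 0`
possesses an MGHD with INCOMPLETE `𝓘⁺` and whose members off `0` are CENSORED (every MGHD has
complete `𝓘⁺`), there are an end `e'` and a tame, immersed, injective curve `F'` of admissible data
through the same base datum, `F' 0 = F 0`, and an `ε > 0` such that for `0 < ‖c‖ < ε` every MGHD of
`F' c` has complete `𝓘⁺` AND settles in the summit's sense (sub-extremal exhaustive decomposition,
`RaysStayInClosure`, honest radii, `IsFutureOriented`) whenever it carries a photon-region remnant
(a late chart on a Kerr exterior `g_{M,a}`, `0 < M`, `|a| ≤ M`, `C²`-converging on all annular slabs).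
Content: near a censorship-violating datum the censoring escape can be steered off the THRESHOLD
stratum (complete, remnant-carrying, non-settling developments: exactly-extremal formation,
self-gravitating photon-shell remnants) — the `hrel` hypothesis shape of
`InitialDataSet.isTameChristodoulouGeneric_of_relative'` (TameGenericityDiagonal.lean) with
`Q = censored`, `P = good`, restricted to violating base data. Why it might fail: a threshold
hypersurface (Kehle–Unger extremal critical collapse, arXiv:2402.10190; Dafermos 2025 §6.4) may contain
violating data in its closure with every censoring curve through them meeting it at parameters
`c_n → 0` (corner data `V ∩ cl T`), or the only censoring curves may run inside `T`. Plausible because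
black holes formed by trapped-surface-forming perturbations of a naked singularity are expected to be
strictly sub-extremal and to decay to Kerr (route crux A `SettlesOutsidePhotonRegions` converts
"censored" into "settles ∨ remnant"; B_S `PhotonRegionThresholdCodim` says `T` itself has positive
codimension). [cite: Christodoulou1999, p. A24] [cite: KehleUnger2025] -/
def LandingAlongCensoredCurves : Prop :=
  ∀ (X : Type) [TopologicalSpace X] [ChartedSpace Literature.Geometry.Lorentzian.E3 X] [IsManifold (𝓡 3) ∞ X] [T2Space X]
    [SecondCountableTopology X] [ConnectedSpace X],
    ∀ (e : Literature.Geometry.Lorentzian.AFEnd X)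
      (F : EuclideanSpace ℝ (Fin 1) → Literature.Geometry.Lorentzian.InitialDataSet (𝓡 3) X),
      Literature.Geometry.Lorentzian.InitialDataSet.IsTameDataFamily e 1 F →
        Literature.Geometry.Lorentzian.InitialDataSet.IsImmersedAtZero 1 F → Function.Injective F →
          (∀ c, F c ∈ Literature.Geometry.Lorentzian.admissibleVacuumData X) →
            (∃ 𝒟 : Literature.Geometry.Lorentzian.VacuumCauchyDevelopment (F 0), 𝒟.IsMaximal ∧
        ¬ Summit.FinalStateConjecture.HasCompleteNullInfinity 𝒟.toCauchyDevelopment) →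
            (∀ c ≠ 0, ∀ 𝒟 : Literature.Geometry.Lorentzian.VacuumCauchyDevelopment (F c), 𝒟.IsMaximal →
              Summit.FinalStateConjecture.HasCompleteNullInfinity 𝒟.toCauchyDevelopment) →
      ∃ (e' : Literature.Geometry.Lorentzian.AFEnd X) (F' : EuclideanSpace ℝ (Fin 1) → Literature.Geometry.Lorentzian.InitialDataSet (𝓡 3) X),
        Literature.Geometry.Lorentzian.InitialDataSet.IsTameDataFamily e' 1 F' ∧
          Literature.Geometry.Lorentzian.InitialDataSet.IsImmersedAtZero 1 F' ∧ F' 0 = F 0 ∧ Function.Injective F' ∧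
            (∀ c, F' c ∈ Literature.Geometry.Lorentzian.admissibleVacuumData X) ∧
              ∃ ε > (0 : ℝ), ∀ c, c ≠ 0 → ‖c‖ < ε →
                ∀ 𝒟 : Literature.Geometry.Lorentzian.VacuumCauchyDevelopment (F' c), 𝒟.IsMaximal → Summit.FinalStateConjecture.HasCompleteNullInfinity 𝒟.toCauchyDevelopment ∧ ((∃ (M a ρ τ₀ : ℝ) (Ψ : ↥(Literature.Geometry.Lorentzian.Kerr.background M a).domain → 𝒟.carrier), 0 < M ∧ |a| ≤ M ∧ 𝒟.toSpacetime.IsLateChart (Literature.Geometry.Lorentzian.Kerr.background M a) (𝒟.metric.causalFuture 𝒟.timeOrientation (Set.range 𝒟.embed)) τ₀ Ψ ∧ ∀ R : ℝ, Filter.Tendsto (fun τ : ℝ ↦ Literature.Geometry.Lorentzian.supCkENorm (Subtype.val '' {x : ↥(Literature.Geometry.Lorentzian.Kerr.background M a).domain | (x : Literature.Geometry.Lorentzian.E4) 0 = τ ∧ ρ ≤ Literature.Geometry.Lorentzian.Kerr.radius a x ∧ Literature.Geometry.Lorentzian.Kerr.radius a x ≤ R}) 2 (𝒟.toSpacetime.deviationExtend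 (Literature.Geometry.Lorentzian.Kerr.background M a) Ψ)) Filter.atTop (nhds 0)) → (∃ (O : Set 𝒟.carrier) (d : Literature.Geometry.Lorentzian.FinalStateDecomposition 𝒟.toSpacetime O 2), (∀ i, Literature.Geometry.Lorentzian.Kerr.IsSubextremal (d.mass i) (d.spin i)) ∧ O = Summit.FinalStateConjecture.exteriorOf 𝒟.toCauchyDevelopment d.charted ∧ Summit.FinalStateConjecture.RaysStayInClosure 𝒟.toCauchyDevelopment O ∧ Summit.FinalStateConjecture.HasExhaustiveCharts d ∧ Summit.FinalStateConjecture.IsFutureOriented d))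

/-! ### Statements of the registered stubs, under the stub names
The skeleton audit reads the hypotheses of `CensorshipViolationCodim_of` BY NAME: each head is a
declared stub. -/
namespace Goal

/-- Statement of `stub_weakCosmicCensorship`. -/
abbrev stub_weakCosmicCensorship : Prop := WeakCosmicCensorshipTame
/-- Statement of `stub_landing`. -/
abbrev stub_landing : Prop := LandingAlongCensoredCurves

end Goal

/-! ## §2 Registered stubs (the two `sorry`s of the file), stated EXPANDED over existing declarations
(Statement + Literature prelude only; no vocabulary of this file occurs in a stub signature). -/

/-- **Stub 1** (XL, open-problem): weak cosmic censorship, tame local form — see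
`WeakCosmicCensorshipTame`. [cite: Christodoulou1999, p. A24] -/
theorem stub_weakCosmicCensorship :
    ∀ (X : Type) [TopologicalSpace X] [ChartedSpace Literature.Geometry.Lorentzian.E3 X] [IsManifold (𝓡 3) ∞ X] [T2Space X]
    [SecondCountableTopology X] [ConnectedSpace X],
    ∀ D ∈ Literature.Geometry.Lorentzian.admissibleVacuumData X,
      (∃ 𝒟 : Literature.Geometry.Lorentzian.VacuumCauchyDevelopment D, 𝒟.IsMaximal ∧
        ¬ Summit.FinalStateConjecture.HasCompleteNullInfinity 𝒟.toCauchyDevelopment) →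
      ∃ (e : Literature.Geometry.Lorentzian.AFEnd X) (F : EuclideanSpace ℝ (Fin 1) → Literature.Geometry.Lorentzian.InitialDataSet (𝓡 3) X),
        Literature.Geometry.Lorentzian.InitialDataSet.IsTameDataFamily e 1 F ∧
          Literature.Geometry.Lorentzian.InitialDataSet.IsImmersedAtZero 1 F ∧ F 0 = D ∧ Function.Injective F ∧
            (∀ c, F c ∈ Literature.Geometry.Lorentzian.admissibleVacuumData X) ∧
              ∃ ε > (0 : ℝ), ∀ c, c ≠ 0 → ‖c‖ < ε →
                ∀ 𝒟 : Literature.Geometry.Lorentzian.VacuumCauchyDevelopment (F c), 𝒟.IsMaximal →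
              Summit.FinalStateConjecture.HasCompleteNullInfinity 𝒟.toCauchyDevelopment := by
  sorry

/-- **Stub 2** (L–XL, open-problem): landing in the good set along censored curves — see
`LandingAlongCensoredCurves`. [cite: Christodoulou1999, p. A24] -/
theorem stub_landing :
    ∀ (X : Type) [TopologicalSpace X] [ChartedSpace Literature.Geometry.Lorentzian.E3 X] [IsManifold (𝓡 3) ∞ X] [T2Space X]
    [SecondCountableTopology X] [ConnectedSpace X],
    ∀ (e : Literature.Geometry.Lorentzian.AFEnd X)
      (F : EuclideanSpace ℝ (Fin 1) → Literature.Geometry.Lorentzian.InitialDataSet (𝓡 3) X),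
      Literature.Geometry.Lorentzian.InitialDataSet.IsTameDataFamily e 1 F →
        Literature.Geometry.Lorentzian.InitialDataSet.IsImmersedAtZero 1 F → Function.Injective F →
          (∀ c, F c ∈ Literature.Geometry.Lorentzian.admissibleVacuumData X) →
            (∃ 𝒟 : Literature.Geometry.Lorentzian.VacuumCauchyDevelopment (F 0), 𝒟.IsMaximal ∧
        ¬ Summit.FinalStateConjecture.HasCompleteNullInfinity 𝒟.toCauchyDevelopment) →
            (∀ c ≠ 0, ∀ 𝒟 : Literature.Geometry.Lorentzian.VacuumCauchyDevelopment (F c), 𝒟.IsMaximal →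
              Summit.FinalStateConjecture.HasCompleteNullInfinity 𝒟.toCauchyDevelopment) →
      ∃ (e' : Literature.Geometry.Lorentzian.AFEnd X) (F' : EuclideanSpace ℝ (Fin 1) → Literature.Geometry.Lorentzian.InitialDataSet (𝓡 3) X),
        Literature.Geometry.Lorentzian.InitialDataSet.IsTameDataFamily e' 1 F' ∧
          Literature.Geometry.Lorentzian.InitialDataSet.IsImmersedAtZero 1 F' ∧ F' 0 = F 0 ∧ Function.Injective F' ∧
            (∀ c, F' c ∈ Literature.Geometry.Lorentzian.admissibleVacuumData X) ∧
              ∃ ε > (0 : ℝ), ∀ c, c ≠ 0 → ‖c‖ < ε →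
                ∀ 𝒟 : Literature.Geometry.Lorentzian.VacuumCauchyDevelopment (F' c), 𝒟.IsMaximal → Summit.FinalStateConjecture.HasCompleteNullInfinity 𝒟.toCauchyDevelopment ∧ ((∃ (M a ρ τ₀ : ℝ) (Ψ : ↥(Literature.Geometry.Lorentzian.Kerr.background M a).domain → 𝒟.carrier), 0 < M ∧ |a| ≤ M ∧ 𝒟.toSpacetime.IsLateChart (Literature.Geometry.Lorentzian.Kerr.background M a) (𝒟.metric.causalFuture 𝒟.timeOrientation (Set.range 𝒟.embed)) τ₀ Ψ ∧ ∀ R : ℝ, Filter.Tendsto (fun τ : ℝ ↦ Literature.Geometry.Lorentzian.supCkENorm (Subtype.val '' {x : ↥(Literature.Geometry.Lorentzian.Kerr.background M a).domain | (x : Literature.Geometry.Lorentzian.E4) 0 = τ ∧ ρ ≤ Literature.Geometry.Lorentzian.Kerr.radius a x ∧ Literature.Geometry.Lorentzian.Kerr.radius a x ≤ R}) 2 (𝒟.toSpacetime.deviationExtend (Literature.Geometry.Lorentzian.Kerr.background M a) Ψ)) Filter.atTop (nhds 0)) → (∃ (O : Set 𝒟.carrier) (d : Literature.Geometry.Lorentzian.FinalStateDecomposition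 𝒟.toSpacetime O 2), (∀ i, Literature.Geometry.Lorentzian.Kerr.IsSubextremal (d.mass i) (d.spin i)) ∧ O = Summit.FinalStateConjecture.exteriorOf 𝒟.toCauchyDevelopment d.charted ∧ Summit.FinalStateConjecture.RaysStayInClosure 𝒟.toCauchyDevelopment O ∧ Summit.FinalStateConjecture.HasExhaustiveCharts d ∧ Summit.FinalStateConjecture.IsFutureOriented d)) := by
  sorry

/-! ## §3 The composition (kernel-checked; no `sorry` of its own) -/

/-- **THE CRUX BY NAME** from the two registered stubs: a locally censoring tame curve through the
violating datum (Stub 1) is made censoring at every `c ≠ 0` by the landed radial reparametrisation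
`InitialDataSet.exists_tameCurve_of_local`; Stub 2 hands back a locally good tame curve through the
same base datum; the same landed lemma globalises it; that is the crux verbatim. [folklore] -/
theorem CensorshipViolationCodim_of :
    Goal.stub_weakCosmicCensorship → Goal.stub_landing → CensorshipViolationCodim := by
  intro hW hL X _ _ _ _ _ _ D hD hV
  -- Step 1 (Stub 1): a tame immersed injective admissible curve through `D`, censored for small `c`
  obtain ⟨e, F, hF, himm, h0, hinj, hadm, ε, hε, hcens⟩ := hW X D hD hV
  -- Step 2 (landed, TameGenericityLocal): reparametrise so that EVERY member off `0` is censored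
  obtain ⟨e₁, F₁, hF₁, h0₁, hinj₁, himm₁, hadm₁, hcens₁⟩ :=
    InitialDataSet.exists_tameCurve_of_local
      (P := fun D' : InitialDataSet (𝓡 3) X ↦
        ∀ 𝒟 : Literature.Geometry.Lorentzian.VacuumCauchyDevelopment D', 𝒟.IsMaximal →
          Summit.FinalStateConjecture.HasCompleteNullInfinity 𝒟.toCauchyDevelopment)
      hF h0 hinj himm hadm hε hcens
  -- Step 3 (Stub 2): land in the good set along the censored curve; its base datum `F₁ 0 = D` is
  -- censorship-violating
  subst h0₁
  obtain ⟨e₂, F₂, hF₂, himm₂, h0₂, hinj₂, hadm₂, ε', hε', hgood⟩ :=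
    hL X e₁ F₁ hF₁ himm₁ hinj₁ hadm₁ hV hcens₁
  -- Step 4 (landed): globalise the good curve; this is the crux's conclusion verbatim
  obtain ⟨e₃, F₃, hF₃, h0₃, hinj₃, himm₃, hadm₃, hgood₃⟩ :=
    InitialDataSet.exists_tameCurve_of_local
      (P := fun D' : InitialDataSet (𝓡 3) X ↦
        ∀ 𝒟 : Literature.Geometry.Lorentzian.VacuumCauchyDevelopment D', 𝒟.IsMaximal → Summit.FinalStateConjecture.HasCompleteNullInfinity 𝒟.toCauchyDevelopment ∧ ((∃ (M a ρ τ₀ : ℝ) (Ψ : ↥(Literature.Geometry.Lorentzian.Kerr.background M a).domain → 𝒟.carrier), 0 < M ∧ |a| ≤ M ∧ 𝒟.toSpacetime.IsLateChart (Literature.Geometry.Lorentzian.Kerr.background M a) (𝒟.metric.causalFuture 𝒟.timeOrientation (Set.range 𝒟.embed)) τ₀ Ψ ∧ ∀ R : ℝ, Filter.Tendsto (fun τ : ℝ ↦ Literature.Geometry.Lorentzian.supCkENorm (Subtype.val '' {x : ↥(Literature.Geometry.Lorentzian.Kerr.background M a).domain | (x : Literature.Geometry.Lorentzian.E4) 0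 = τ ∧ ρ ≤ Literature.Geometry.Lorentzian.Kerr.radius a x ∧ Literature.Geometry.Lorentzian.Kerr.radius a x ≤ R}) 2 (𝒟.toSpacetime.deviationExtend (Literature.Geometry.Lorentzian.Kerr.background M a) Ψ)) Filter.atTop (nhds 0)) → (∃ (O : Set 𝒟.carrier) (d : Literature.Geometry.Lorentzian.FinalStateDecomposition 𝒟.toSpacetime O 2), (∀ i, Literature.Geometry.Lorentzian.Kerr.IsSubextremal (d.mass i) (d.spin i)) ∧ O = Summit.FinalStateConjecture.exteriorOf 𝒟.toCauchyDevelopment d.charted ∧ Summit.FinalStateConjecture.RaysStayInClosure 𝒟.toCauchyDevelopment O ∧ Summit.FinalStateConjecture.HasExhaustiveCharts d ∧ Summit.FinalStateConjecture.IsFutureOriented d)))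
      hF₂ h0₂ hinj₂ himm₂ hadm₂ hε' hgood
  exact ⟨e₃, F₃, hF₃, himm₃, h0₃, hinj₃, hadm₃, hgood₃⟩

/-! ### Consistency: each registered stub, stated EXPANDED, IS the named statement of §1. -/

theorem weakCosmicCensorshipTame_holds : WeakCosmicCensorshipTame := stub_weakCosmicCensorship
theorem landingAlongCensoredCurves_holds : LandingAlongCensoredCurves := stub_landing

/-- **The crux from the skeleton** (closed modulo the two `sorry`s). [folklore] -/
theorem CensorshipViolationCodim_proof : CensorshipViolationCodim :=
  CensorshipViolationCodim_of stub_weakCosmicCensorship stub_landing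

/-! ### Sanity (no `sorry`): the crux implies each stub — both are genuine WEAKENINGS of the crux
(so the pair is jointly equivalent to it, neither alone). -/

/-- The crux implies Stub 1 (forget settling; `ε = 1`). [folklore] -/
theorem weakCosmicCensorshipTame_of_crux (h : CensorshipViolationCodim) :
    WeakCosmicCensorshipTame := by
  intro X _ _ _ _ _ _ D hD hV
  obtain ⟨e, F, hF, himm, h0, hinj, hadm, hgood⟩ := h X D hD hV
  exact ⟨e, F, hF, himm, h0, hinj, hadm, 1, one_pos,
    fun c hc _ 𝒟 h𝒟 ↦ (hgood c hc 𝒟 h𝒟).1⟩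

/-- The crux implies Stub 2 (ignore the given curve; `ε = 1`). [folklore] -/
theorem landingAlongCensoredCurves_of_crux (h : CensorshipViolationCodim) :
    LandingAlongCensoredCurves := by
  intro X _ _ _ _ _ _ e F _ _ _ hadm hV _
  obtain ⟨e', F', hF', himm', h0', hinj', hadm', hgood⟩ := h X (F 0) (hadm 0) hV
  exact ⟨e', F', hF', himm', h0', hinj', hadm', 1, one_pos, fun c hc _ ↦ hgood c hc⟩

end Summit.FinalStateConjecture.FinalStateConjecture.Cruxes.CensorshipViolationCodim.Birth

end
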